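import Summits.CriticalPhenomena.PercolationContinuityZ3.Theorems.Transplant.CayleyMilnorGlideHcp
import HarnessLib

/-!
# Milnor's kernel lemma, IX: the TRIGONAL-PRISMATIC net (RCSR symbol `acs`: the inter-layer contact graph of the hexagonal close packing) is a
# customer of the one-type scaled node through the same `c`-glide — `θ_v(p_c(acs)) = 0` at every vertex modulo `SamePDropOfSkeletonFrmScaled₁`

builds on p205010 (kernel theorem, internal audit signed; external expert review pending) — nothing in this file uses p205010.  The percolation
theorem is CONDITIONAL on the OPEN node `SamePDropOfSkeletonFrmScaled₁` (hypothesis `hN`; nothing is claimed about it) and on NOTHING ELSE.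
Lane `prim-bschramm`, seat `prim-bschramm-p4` gen 18 (PART C3 of `P4-GENERAL.md` §40.4).  Helper file (`--supports stmt-CriticalPhenomena-4575`).

THE GRAPH.  In the lane's integer model of the hexagonal close packing (`Hcp.hcpGraph`, file `HcpNoConc`: A layers `x₂` even, B layers `x₂` odd)
keep only the SIX INTER-LAYER contacts of each site — three to the layer above, three to the layer below, at the vertices of a trigonal prism:
`Acs.bonds e = (Hcp.bonds e).filter (·₂ ≠ 0)`, `Acs.acsGraph := fromRel (y − x ∈ Acs.bonds (evenLayer x))`.  This is the 6-coordinated uninodal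
net `acs` (vertices at the Wyckoff positions 2c of `P6₃/mmc`, as in hcp; the trigonal-prismatic net of the WC type), listed in the lane's
class map (P2-LATTICES §49/§61) in the "method-void" row.  It is a spanning subgraph of hcp (`Acs.acs_le_hcp`), 6-regular, connected (every hcp
contact is an `acs`-path of length `≤ 2`: `Acs.two_step`, by `decide`), and invariant under the horizontal translations and the `c`-glide
`(a, b, z) ↦ (−b, −a, z + 1)` (`Acs.lam3_mem_bonds`, by `decide`).  So the screw/glide criterion (file VI, `Glide3.criticalContinuity`) applies with
`ℓ(a, b) = a − b`: **`Acs.criticalContinuity_of_frmScaledNode₁ (hN) (v) : θ_v(p_c(acs)) = 0`**.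
[cite: BenjaminiSchramm1996, Conj. 4; §2] [cite: ConwaySloane1999, Ch. 4 §6.1 (the hexagonal close packing)] [cite: MilnorSolvableGrowth1968, Lemma 1]
-/

noncomputable section

namespace Summit.CriticalPhenomena.PercolationContinuityZ3.Theorems.Transplant

open SimpleGraph Literature.Probability.LatticeModels Literature.Probability.Percolation

namespace Acs

open Hcp Glide3

/-! ## §1 The trigonal-prismatic net as the inter-layer contact graph of hcp -/

/-- The bond vectors of `acs` from an A site (`true`) / a B site (`false`): the six inter-layer contacts of hcp.
[cite: ConwaySloane1999, Ch. 4 §6.1] -/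
def bonds (e : Bool) : Finset (Site 3) := (Hcp.bonds e).filter fun v => v 2 ≠ 0

/-- Membership in the `acs` bond table. [folklore] -/
theorem mem_bonds {e : Bool} {v : Site 3} : v ∈ bonds e ↔ v ∈ Hcp.bonds e ∧ v 2 ≠ 0 := Finset.mem_filter

/-- There are six bonds from every site (a trigonal prism). [cite: ConwaySloane1999, Ch. 4 §6.1] -/
theorem card_bonds : ∀ e : Bool, (bonds e).card = 6 := by decide

/-- `0` is not a bond. [folklore] -/
theorem zero_notMem_bonds : ∀ e : Bool, (0 : Site 3) ∉ bonds e := by decide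

/-- The bond table is symmetric: the reverse of a bond from an `e`-site is a bond from its far end. [folklore] -/
theorem neg_mem_bonds : ∀ e : Bool, ∀ v ∈ bonds e, -v ∈ bonds (tgt e v) := by decide

/-- Bonds change the layer by exactly one (in particular by at most one). [folklore] -/
theorem bonds_apply_two : ∀ e : Bool, ∀ v ∈ bonds e, v 2 = 0 ∨ v 2 = 1 ∨ v 2 = -1 := by decide

/-- **The `acs` net** on `ℤ³`. [cite: ConwaySloane1999, Ch. 4 §6.1] -/
def acsGraph : SimpleGraph (Site 3) := SimpleGraph.fromRel fun x y => y - x ∈ bonds (evenLayer x)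

/-- **Adjacency: `y − x` is an `acs` bond from the layer type of `x`.** [folklore] -/
theorem acs_adj_iff (x y : Site 3) : acsGraph.Adj x y ↔ y - x ∈ bonds (evenLayer x) := by
  rw [acsGraph, SimpleGraph.fromRel_adj]
  constructor
  · rintro ⟨-, h | h⟩
    · exact h
    · have h' := neg_mem_bonds _ _ h
      rw [neg_sub] at h'
      have hy : evenLayer x = tgt (evenLayer y) (x - y) := by
        have := evenLayer_add y (x - y) (bonds_apply_two _ _ h)
        rwa [add_sub_cancel] at this
      rwa [hy]
  · intro h
    refine ⟨fun hxy => zero_notMem_bonds (evenLayer x) ?_, Or.inl h⟩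
    subst hxy
    rwa [sub_self] at h

/-- **`acs` is a spanning subgraph of hcp.** [folklore] -/
theorem acs_le_hcp : acsGraph ≤ hcpGraph := fun x y h => by
  rw [acs_adj_iff] at h
  rw [hcp_adj_iff]
  exact (mem_bonds.1 h).1

/-- `acs` is locally finite (a subgraph of the locally finite hcp). [folklore] -/
instance acsGraph_locallyFinite : acsGraph.LocallyFinite := fun x =>
  ((hcpGraph.neighborSet x).toFinite.subset fun _ hy => acs_le_hcp hy).fintype

/-! ## §2 Connectedness: every hcp contact is an `acs`-path of length at most two -/

/-- **Two-step table**: every hcp bond from an `e`-site either is an `acs` bond or factors as an `acs` bond `w` followed by an `acs` bond `v − w`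
from the far end of `w`. [folklore] -/
theorem two_step : ∀ e : Bool, ∀ v ∈ Hcp.bonds e, v ∈ bonds e ∨ ∃ w ∈ bonds e, v - w ∈ bonds (tgt e w) := by decide

/-- Every hcp edge is joined by an `acs` walk. [folklore] -/
theorem reachable_of_hcp_adj {x y : Site 3} (h : hcpGraph.Adj x y) : acsGraph.Reachable x y := by
  rw [hcp_adj_iff] at h
  rcases two_step _ _ h with h1 | ⟨w, hw, hvw⟩
  · exact Adj.reachable ((acs_adj_iff x y).2 h1)
  · have h2 : acsGraph.Adj x (x + w) := by rw [acs_adj_iff, add_sub_cancel_left]; exact hw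
    have h3 : acsGraph.Adj (x + w) y := by
      rw [acs_adj_iff, evenLayer_add x w (bonds_apply_two _ _ hw)]
      rwa [show y - (x + w) = y - x - w by abel]
    exact h2.reachable.trans h3.reachable

/-- **`acs` is connected** (hcp is, and hcp edges are `acs`-reachable). [cite: ConwaySloane1999, Ch. 4 §6.1] -/
theorem connected : acsGraph.Connected := by
  refine (connected_iff _).2 ⟨fun x y => ?_, ⟨0⟩⟩
  obtain ⟨p⟩ := Hcp.connected.preconnected x y
  induction p with
  | nil => exact Reachable.refl _
  | cons h _ ih => exact (reachable_of_hcp_adj h).trans ih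

/-! ## §3 The glide group acts; the theorem -/

/-- The linear part of the `c`-glide maps the `acs` contacts of an A site onto those of a B site and conversely. [folklore] -/
theorem lam3_mem_bonds : ∀ e : Bool, ∀ v ∈ bonds e, lam3 v ∈ bonds (!e) := by decide

/-- **The `c`-glide is an automorphism of `acs`.** [folklore] -/
theorem glide_adj_iff (x y : Site 3) : acsGraph.Adj (glide lam x) (glide lam y) ↔ acsGraph.Adj x y := by
  rw [acs_adj_iff, acs_adj_iff, glide_sub, evenLayer_glide]
  constructor
  · intro h
    have := lam3_mem_bonds _ _ h
    rwa [lam3_lam3, Bool.not_not] at this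
  · intro h
    exact lam3_mem_bonds _ _ h

/-- Horizontal translations are automorphisms of `acs`. [folklore] -/
theorem translate_adj_iff (u : Site 2) (x y : Site 3) : acsGraph.Adj (x + mk u 0) (y + mk u 0) ↔ acsGraph.Adj x y := by
  rw [acs_adj_iff, acs_adj_iff, add_sub_add_right_eq_sub, add_comm x, evenLayer_add_even _ _ (by simp)]

/-- **THEOREM (modulo the scaled node ALONE): `θ_v(p_c(acs)) = 0` at every vertex of the trigonal-prismatic net** — the glide group
`ℤ² ⋊_{lam} ℤ` acts freely and transitively by automorphisms with the rank-2 character `(u, k) ↦ (u₀ − u₁, k)`.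
[cite: BenjaminiSchramm1996, Conj. 4; §2] [cite: MilnorSolvableGrowth1968, Lemma 1] -/
theorem criticalContinuity_of_frmScaledNode₁ (hN : SamePDropOfSkeletonFrmScaled₁) (v : Site 3) :
    theta acsGraph v (criticalProbIOf acsGraph v) = 0 :=
  Glide3.criticalContinuity lam hN acsGraph connected translate_adj_iff glide_adj_iff ell ell_lam _ ell_ne_zero v

/-- … and `θ_v(p) = 0` on `acs` for every `p ≤ p_c`. [cite: BenjaminiSchramm1996, Conj. 4; §2] -/
theorem theta_eq_zero_of_le_of_frmScaledNode₁ (hN : SamePDropOfSkeletonFrmScaled₁) (v : Site 3) {p : unitInterval}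
    (hp : (p : ℝ) ≤ criticalProb acsGraph v) : theta acsGraph v p = 0 :=
  Glide3.theta_eq_zero_of_le lam hN acsGraph connected translate_adj_iff glide_adj_iff ell ell_lam _ ell_ne_zero v hp

end Acs

end Summit.CriticalPhenomena.PercolationContinuityZ3.Theorems.Transplant

end
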